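import Mathlib.Analysis.Calculus.InverseFunctionTheorem.ContDiff
import Mathlib.Analysis.Calculus.InverseFunctionTheorem.Deriv
import Mathlib.Analysis.Calculus.Deriv.MeanValue
import Mathlib.Topology.Order.IntermediateValue
import HarnessLib

/-!
# The smooth inverse of a real function with positive derivative on an interval

Topic `Literature/Analysis/Calculus`. Let `s ⊆ ℝ` be an open interval (an open order-connected set, bounded or
not) and `f : ℝ → ℝ` of class `C^n`, `n ≥ 1` (any `n : WithTop ℕ∞`, so `C^∞` and `C^ω` are included), on `s`
with `f′ > 0` on `s`. Then `f` is strictly increasing on `s`, its image `f '' s` is again an open interval, and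
the inverse `g := Function.invFunOn f s` is of class `C^n` on `f '' s`, strictly increasing, maps `f '' s` onto
`s`, and has derivative `g′(y) = 1/f′(g y)` (`exists_contDiffOn_inverse_of_deriv_pos` packages everything;
the individual facts are `strictMonoOn_of_deriv_pos'`, `isOpen_image_of_deriv_pos`,
`ordConnected_image_of_continuousOn`, `contDiffOn_invFunOn_of_deriv_pos`, `hasDerivAt_invFunOn_of_deriv_pos`).
This is the global, one-dimensional, arbitrary-order form of the inverse function theorem that radial
reparametrisations need (e.g. inverting the areal-radius profile `ϱ(s)` of a spherically symmetric slice to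
read it as a graph over the Kerr–Schild radius); Mathlib has the LOCAL statements
(`ContDiffAt.to_localInverse`, `HasStrictDerivAt.to_local_left_inverse`,
`HasStrictFDerivAt.localInverse_unique`) and the tree only a `C¹` version on bounded intervals with prescribed
image (`Literature.ModelTheory.ExponentialFields.PilaWilkie.contDiffOn_inverse`). Rudin, *Principles of
Mathematical Analysis*, Thm. 5.? / Spivak, *Calculus*, Ch. 12, Thm. 5 (inverse of an increasing
differentiable function) — folklore.

Everything is proved; no definitions, no named facts.

## References

* M. Spivak, *Calculus*, 3rd ed. (1994), Ch. 12, Thm. 5; W. Rudin, *Principles of Mathematical Analysis*,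
  3rd ed. (1976), Thm. 9.24 (inverse function theorem). [folklore]
-/

noncomputable section

open Set Function Filter
open scoped Topology

namespace Literature.Analysis.Calculus

variable {f : ℝ → ℝ} {s : Set ℝ} {n : WithTop ℕ∞}

/-- A function with positive derivative on an open interval is strictly increasing there (Mathlib's
`strictMonoOn_of_deriv_pos` on the convex set `s`, whose interior is `s`). [folklore] -/
theorem strictMonoOn_of_deriv_pos' (hs' : s.OrdConnected) (hf : ContinuousOn f s)
    (hpos : ∀ x ∈ s, 0 < deriv f x) : StrictMonoOn f s :=
  strictMonoOn_of_deriv_pos hs'.convex hf fun x hx ↦ hpos x (interior_subset hx)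

/-- The image of an open interval under a continuous strictly increasing function is open: around `f x₀` it
contains `(f x₁, f x₂)` for `x₁ < x₀ < x₂` in `s` (intermediate value theorem). [folklore] -/
theorem isOpen_image_of_strictMonoOn (hs : IsOpen s) (hs' : s.OrdConnected) (hf : ContinuousOn f s)
    (hmono : StrictMonoOn f s) : IsOpen (f '' s) := by
  rw [isOpen_iff_mem_nhds]
  rintro _ ⟨x₀, hx₀, rfl⟩
  -- room on both sides of `x₀` inside the open set `s`
  obtain ⟨ε, hε, hball⟩ := Metric.isOpen_iff.1 hs x₀ hx₀
  have hx₁ : x₀ - ε / 2 ∈ s := hball (by rw [Metric.mem_ball, Real.dist_eq]; rw [abs_of_nonpos (by linarith)]; linarith)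
  have hx₂ : x₀ + ε / 2 ∈ s := hball (by rw [Metric.mem_ball, Real.dist_eq]; rw [abs_of_nonneg (by linarith)]; linarith)
  have hIcc : Icc (x₀ - ε / 2) (x₀ + ε / 2) ⊆ s := hs'.out hx₁ hx₂
  have hcont : ContinuousOn f (Icc (x₀ - ε / 2) (x₀ + ε / 2)) := hf.mono hIcc
  have hivt := intermediate_value_Ioo (by linarith : x₀ - ε / 2 ≤ x₀ + ε / 2) hcont
  have hlt₁ : f (x₀ - ε / 2) < f x₀ := hmono hx₁ hx₀ (by linarith)
  have hlt₂ : f x₀ < f (x₀ + ε / 2) := hmono hx₀ hx₂ (by linarith)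
  refine mem_of_superset (isOpen_Ioo.mem_nhds ⟨hlt₁, hlt₂⟩) fun y hy ↦ ?_
  obtain ⟨x, hx, rfl⟩ := hivt hy
  exact ⟨x, hIcc (Ioo_subset_Icc_self hx), rfl⟩

/-- The image of an open interval under a function with positive derivative is open. [folklore] -/
theorem isOpen_image_of_deriv_pos (hs : IsOpen s) (hs' : s.OrdConnected) (hf : ContinuousOn f s)
    (hpos : ∀ x ∈ s, 0 < deriv f x) : IsOpen (f '' s) :=
  isOpen_image_of_strictMonoOn hs hs' hf (strictMonoOn_of_deriv_pos' hs' hf hpos)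

/-- The image of an interval under a continuous function is an interval (order-connected): continuous images
of preconnected sets are preconnected. [folklore] -/
theorem ordConnected_image_of_continuousOn (hs' : s.OrdConnected) (hf : ContinuousOn f s) :
    (f '' s).OrdConnected :=
  isPreconnected_iff_ordConnected.1 ((isPreconnected_iff_ordConnected.2 hs').image f hf)

/-- On the image, `Function.invFunOn f s` is a right inverse of `f` with values in `s`. [folklore] -/
theorem invFunOn_image_mem_and_eq {y : ℝ} (hy : y ∈ f '' s) :
    invFunOn f s y ∈ s ∧ f (invFunOn f s y) = y := by
  obtain ⟨x, hx, rfl⟩ := hy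
  exact invFunOn_pos ⟨x, hx, rfl⟩

/-- For an injective `f` on `s`, `Function.invFunOn f s` is a left inverse on `s`. [folklore] -/
theorem invFunOn_apply_of_injOn (hinj : InjOn f s) {x : ℝ} (hx : x ∈ s) : invFunOn f s (f x) = x :=
  hinj.leftInvOn_invFunOn hx

/-- The inverse of a strictly increasing function is strictly increasing on the image. [folklore] -/
theorem strictMonoOn_invFunOn (hmono : StrictMonoOn f s) : StrictMonoOn (invFunOn f s) (f '' s) := by
  intro y₁ hy₁ y₂ hy₂ hlt
  obtain ⟨h₁s, h₁⟩ := invFunOn_image_mem_and_eq hy₁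
  obtain ⟨h₂s, h₂⟩ := invFunOn_image_mem_and_eq hy₂
  by_contra hle
  push Not at hle
  have := hmono.monotoneOn h₂s h₁s hle
  rw [h₁, h₂] at this
  exact absurd hlt (not_lt.2 this)

/-- **The inverse is `C^n`.** If `f` is `C^n` (`n ≥ 1`) on the open interval `s` with `f′ > 0` there, then
`Function.invFunOn f s` is `C^n` on the open interval `f '' s`: at `y₀ = f x₀` it agrees near `y₀` with
Mathlib's local inverse `ContDiffAt.localInverse` (uniqueness of local left inverses,
`HasStrictFDerivAt.localInverse_unique`), which is `C^n` (`ContDiffAt.to_localInverse`). [folklore] -/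
theorem contDiffOn_invFunOn_of_deriv_pos (hs : IsOpen s) (hs' : s.OrdConnected) (hf : ContDiffOn ℝ n f s)
    (hn : 1 ≤ n) (hpos : ∀ x ∈ s, 0 < deriv f x) : ContDiffOn ℝ n (invFunOn f s) (f '' s) := by
  have hn0 : n ≠ 0 := by
    rintro rfl
    exact absurd hn (by norm_num)
  have hmono := strictMonoOn_of_deriv_pos' hs' hf.continuousOn hpos
  have hopen := isOpen_image_of_strictMonoOn hs hs' hf.continuousOn hmono
  set g := invFunOn f s with hg
  refine fun y hy ↦ (?_ : ContDiffAt ℝ n g y).contDiffWithinAt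
  obtain ⟨x₀, hx₀, rfl⟩ := hy
  have hfa : ContDiffAt ℝ n f x₀ := hf.contDiffAt (hs.mem_nhds hx₀)
  have hne : deriv f x₀ ≠ 0 := (hpos x₀ hx₀).ne'
  -- the derivative as a continuous linear equivalence
  set e : ℝ ≃L[ℝ] ℝ := ContinuousLinearEquiv.unitsEquivAut ℝ (Units.mk0 (deriv f x₀) hne) with he
  have hder : HasDerivAt f (deriv f x₀) x₀ := (hfa.differentiableAt (by simpa using hn0)).hasDerivAt
  have hf' : HasFDerivAt f (e : ℝ →L[ℝ] ℝ) x₀ := by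
    have h := hder.hasFDerivAt
    have heq : (e : ℝ →L[ℝ] ℝ) = (1 : ℝ →L[ℝ] ℝ).smulRight (deriv f x₀) := by
      ext
      simp [he]
    rw [heq]
    exact h
  have hloc : ContDiffAt ℝ n (hfa.localInverse hf' hn0) (f x₀) := hfa.to_localInverse hf' hn0
  -- `g` is a left inverse of `f` near `x₀`, hence agrees with the local inverse near `f x₀`
  have hleft : ∀ᶠ x in 𝓝 x₀, g (f x) = x :=
    mem_of_superset (hs.mem_nhds hx₀) fun x hx ↦ invFunOn_apply_of_injOn hmono.injOn hx
  have heq : ∀ᶠ z in 𝓝 (f x₀), g z = hfa.localInverse hf' hn0 z :=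
    (hfa.hasStrictFDerivAt' hf' hn0).localInverse_unique hleft
  exact hloc.congr_of_eventuallyEq heq

/-- **Derivative of the inverse**: under the same hypotheses, `(invFunOn f s)′(y) = (f′(invFunOn f s y))⁻¹`
at every `y ∈ f '' s` (Mathlib `HasStrictDerivAt.to_local_left_inverse`). [folklore] -/
theorem hasDerivAt_invFunOn_of_deriv_pos (hs : IsOpen s) (hs' : s.OrdConnected) (hf : ContDiffOn ℝ n f s)
    (hn : 1 ≤ n) (hpos : ∀ x ∈ s, 0 < deriv f x) {y : ℝ} (hy : y ∈ f '' s) :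
    HasDerivAt (invFunOn f s) (deriv f (invFunOn f s y))⁻¹ y := by
  have hn0 : n ≠ 0 := by
    rintro rfl
    exact absurd hn (by norm_num)
  have hmono := strictMonoOn_of_deriv_pos' hs' hf.continuousOn hpos
  obtain ⟨hxs, hfx⟩ := invFunOn_image_mem_and_eq hy
  set x₀ := invFunOn f s y with hx₀
  have hfa : ContDiffAt ℝ n f x₀ := hf.contDiffAt (hs.mem_nhds hxs)
  have hstrict : HasStrictDerivAt f (deriv f x₀) x₀ := hfa.hasStrictDerivAt hn0
  have hleft : ∀ᶠ x in 𝓝 x₀, invFunOn f s (f x) = x :=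
    mem_of_superset (hs.mem_nhds hxs) fun x hx ↦ invFunOn_apply_of_injOn hmono.injOn hx
  have h := (hstrict.to_local_left_inverse (hpos x₀ hxs).ne' hleft).hasDerivAt
  rwa [hfx] at h

/-- **The smooth inverse of a function with positive derivative on an open interval** (everything packaged).
For `s` an open interval and `f ∈ C^n(s)`, `n ≥ 1`, with `f′ > 0` on `s`: the image `t := f '' s` is an open
interval and `g := Function.invFunOn f s` satisfies `g ∈ C^n(t)`, `g ∘ f = id` on `s`, `f ∘ g = id` on `t`,
`g(t) ⊆ s`, `f` and `g` strictly increasing, `g′(y) = 1/f′(g y)` on `t`. Spivak, *Calculus*, Ch. 12, Thm. 5;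
Rudin 1976, Thm. 9.24. [folklore] -/
theorem exists_contDiffOn_inverse_of_deriv_pos (hs : IsOpen s) (hs' : s.OrdConnected)
    (hf : ContDiffOn ℝ n f s) (hn : 1 ≤ n) (hpos : ∀ x ∈ s, 0 < deriv f x) :
    ∃ g : ℝ → ℝ, IsOpen (f '' s) ∧ (f '' s).OrdConnected ∧ ContDiffOn ℝ n g (f '' s) ∧
      (∀ x ∈ s, g (f x) = x) ∧ (∀ y ∈ f '' s, f (g y) = y) ∧ MapsTo g (f '' s) s ∧
      StrictMonoOn f s ∧ StrictMonoOn g (f '' s) ∧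
      ∀ y ∈ f '' s, HasDerivAt g (deriv f (g y))⁻¹ y := by
  have hmono := strictMonoOn_of_deriv_pos' hs' hf.continuousOn hpos
  refine ⟨invFunOn f s, isOpen_image_of_strictMonoOn hs hs' hf.continuousOn hmono,
    ordConnected_image_of_continuousOn hs' hf.continuousOn, contDiffOn_invFunOn_of_deriv_pos hs hs' hf hn hpos,
    fun x hx ↦ invFunOn_apply_of_injOn hmono.injOn hx, fun y hy ↦ (invFunOn_image_mem_and_eq hy).2,
    fun y hy ↦ (invFunOn_image_mem_and_eq hy).1, hmono, strictMonoOn_invFunOn hmono,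
    fun y hy ↦ hasDerivAt_invFunOn_of_deriv_pos hs hs' hf hn hpos hy⟩

/-- The image interval made explicit for the most common shape `s = Set.Ioi a` with `f x → ∞`: if moreover
`f` tends to `+∞` along `atTop` and `f x → c` as `x → a⁺`, then `f '' Ioi a = Ioi c`. [folklore] -/
theorem image_Ioi_of_strictMonoOn_of_tendsto {a c : ℝ} (hf : ContinuousOn f (Ioi a)) (hmono : StrictMonoOn f (Ioi a))
    (htop : Tendsto f atTop atTop) (hbot : Tendsto f (𝓝[>] a) (𝓝 c)) : f '' Ioi a = Ioi c := by
  apply Subset.antisymm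
  · rintro _ ⟨x, hx, rfl⟩
    -- `f x > c`: pick `a < x' < x`; then `f x' < f x` and `f x' ≥ c` would need a limit argument; instead use
    -- that `f` is strictly increasing and `f z → c` as `z → a⁺` with `f z < f x` for `z < x`
    have hev : ∀ᶠ z in 𝓝[>] a, f z < f ((a + x) / 2) := by
      have hmid : a < (a + x) / 2 := by simp only [mem_Ioi] at hx; linarith
      filter_upwards [Ioo_mem_nhdsGT hmid] with z hz
      exact hmono hz.1 (show (a + x) / 2 ∈ Ioi a from hmid) hz.2
    have hle : c ≤ f ((a + x) / 2) := le_of_tendsto hbot (hev.mono fun z hz ↦ hz.le)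
    have hlt : f ((a + x) / 2) < f x := by
      simp only [mem_Ioi] at hx
      exact hmono (show (a + x) / 2 ∈ Ioi a by simp only [mem_Ioi]; linarith) hx (by linarith)
    exact lt_of_le_of_lt hle hlt
  · intro y hy
    simp only [mem_Ioi] at hy
    -- some `x₁ > a` with `f x₁ < y` (limit at `a⁺`) and some `x₂` with `y < f x₂` (limit at `∞`)
    have h₁ : ∀ᶠ z in 𝓝[>] a, f z < y := (tendsto_order.1 hbot).2 y hy
    obtain ⟨x₁, hx₁y, hx₁⟩ := (h₁.and self_mem_nhdsWithin).exists
    have h₂ : ∀ᶠ z in atTop, y < f z := htop.eventually (eventually_gt_atTop y)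
    obtain ⟨x₂, hx₂y, hx₂⟩ := (h₂.and (eventually_gt_atTop x₁)).exists
    have hx₁x₂ : x₁ ≤ x₂ := hx₂.le
    have hIcc : Icc x₁ x₂ ⊆ Ioi a := fun z hz ↦ lt_of_lt_of_le hx₁ hz.1
    obtain ⟨x, hx, rfl⟩ := intermediate_value_Ioo hx₁x₂ (hf.mono hIcc) ⟨hx₁y, hx₂y⟩
    exact ⟨x, hIcc (Ioo_subset_Icc_self hx), rfl⟩

end Literature.Analysis.Calculus

end
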